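import Summits.NavierStokesRegularity.NavierStokesRegularity.Theorems.ExtremiserTransiencePerFlowNearEfficientRecurrence
import Summits.NavierStokesRegularity.NavierStokesRegularity.Theorems.ExtremiserTransienceNearExtremalTransienceThetaOne
import HarnessLib

/-!
# Route `ExtremiserTransience`, LINE g4-α «per-flow-tangent» (ns-idea-5 g4): efficient times have FULL LOGARITHMIC DENSITY

`--supports stmt-NavierStokesRegularity-26568` (`TangentExtremalExtraction`; strengthens the recurrence input of the skeleton).

`nearEfficient_recurrence_of_not_perFlow` (p616708) says: if the per-flow conclusion of `NearExtremalTransiencePerFlow` fails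
for a classical Leray–Hopf rapidly-decaying-datum flow on `[0,T)`, the strictly `m`-efficient late times (`m < κ⋆`) form a
non-null set.  This file proves the sharp form of that statement, with the same elementary mechanism pushed to the end:

* `efficientTimes_logDensity_of_not_perFlow` — there is a measurable coefficient `k : ℝ → [0,1]` (the canonical, minimal
  flow-wise depletion coefficient: `|∫ω·Sω| ≤ k(t)·M·‖ω‖₂·‖∇ω‖₂` for every bound `M ≥ sup|u(t)|`, `k ≤ κ⋆` on `[0,T)`, and
  `k(t) > m ≥ 0` forces strict `m`-efficiency at `t`) such that, if the per-flow conclusion fails, then for EVERY `m < κ⋆`,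
  EVERY `δ < 1`, every `B` and every onset `t₁ < T` some `t ∈ [t₁,T)` has
  `∫_(t₁)^t 1_(k > m)(τ) dτ/(T−τ) > δ·log((T−t₁)/(T−t)) + B`:
  the `m`-efficient times have UPPER LOGARITHMIC DENSITY ONE at the blow-up time (w.r.t. `dτ/(T−τ)`), for every `m < κ⋆`.
  Proof: otherwise `k² ≤ m₊² + (κ⋆² − m₊²)·1_(k>m)` pointwise gives the coefficient budget
  `∫k²/(T−τ) ≤ (m₊² + (κ⋆²−m₊²)δ₊)·log + B'`, i.e. the flow-wise certificate with `θ² = (m₊² + (κ⋆²−m₊²)δ₊)/κ⋆² < 1`.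

Reading for the line: a Type-I flow violating per-flow transience is near-extremal (`k > κ⋆ − ε`) at log-almost all late
times, not merely on a non-null set; every "at a non-null set of efficient times" statement of the skeleton (floor, cap,
lower lock, `stub_upperLock`) may be read on a set of full upper logarithmic density.  HONEST FRAMING: nothing about
Navier–Stokes regularity or blow-up is proved; items 26567/26568 stay open. [folklore]
-/

noncomputable section
open Set Filter Topology MeasureTheory
open scoped InnerProductSpace RealInnerProductSpace ENNReal NNReal ContDiff
open Literature.Analysis.FluidPDE

namespace Summit.NavierStokesRegularity.NavierStokesRegularity.Theorems.DepletionLadder.PerFlow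
set_option linter.dupNamespace false
set_option linter.style.longLine false

/-- **Full logarithmic density of efficient times.** See the module docstring. [folklore] -/
theorem efficientTimes_logDensity_of_not_perFlow {ν T : ℝ} (hν : 0 < ν) (hT : 0 < T)
    {u : ℝ → EuclideanSpace ℝ (Fin 3) → EuclideanSpace ℝ (Fin 3)} {p : ℝ → EuclideanSpace ℝ (Fin 3) → ℝ}
    (hsol : IsClassicalNSSolutionOn (Ico 0 T) ν 0 u p) (hLH : IsLerayHopfOn T ν 0 (u 0) u)
    (hdec : HasRapidSpatialDecay (u 0))
    (hnot : ¬ (∃ θ : ℝ, 0 ≤ θ ∧ θ < 1 ∧ ∀ κ : ℝ, (∀ (v : EuclideanSpace ℝ (Fin 3) → EuclideanSpace ℝ (Fin 3)) (M B : ℝ), ContDiff ℝ (⊤ : ℕ∞) v → Literature.Analysis.FluidPDE.VectorCalculus.IsDivFree v → (∀ x, ‖v x‖ ≤ M) → (∀ x, ‖fderiv ℝ v x‖ ≤ B) → (∫⁻ x, ‖iteratedFDeriv ℝ 0 v x‖ₑ ^ 2 < ⊤) → (∫⁻ x, ‖iteratedFDeriv ℝ 1 v x‖ₑ ^ 2 <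 ⊤) → (∫⁻ x, ‖iteratedFDeriv ℝ 2 v x‖ₑ ^ 2 < ⊤) → |∫ x, ⟪Literature.Analysis.FluidPDE.curl v x, fderiv ℝ v x (Literature.Analysis.FluidPDE.curl v x)⟫_ℝ| ≤ κ * M * Real.sqrt (∫ x, ‖Literature.Analysis.FluidPDE.curl v x‖ ^ 2) * Real.sqrt (∫ x, Literature.Analysis.FluidPDE.frobeniusNormSq (fderiv ℝ (Literature.Analysis.FluidPDE.curl v) x))) → ∃ t₁ ∈ Set.Ico 0 T, ∃ (k : ℝ → ℝ) (B : ℝ), Measurable k ∧ (∀ τ, 0 ≤ k τ ∧ k τ ≤ 1) ∧ (∀ t ∈ Set.Ico t₁ T, ∀ M : ℝ, (∀ x, ‖u t x‖ ≤ M) → |∫ x, ⟪Literature.Analysis.FluidPDE.curl (u t) x, fderiv ℝ (u t) x (Literature.Analysis.FluidPDE.curl (u t) x)⟫_ℝ| ≤ k t * M * Real.sqrt (∫ x, ‖Literature.Analysis.FluidPDE.curl (u t) x‖ ^ 2) * Real.sqrt (∫ x, Literature.Analysis.FluidPDE.frobeniusNormSq (fderiv ℝ (Literature.Analysis.FluidPDE.curl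 (u t)) x))) ∧ (∀ t ∈ Set.Ico t₁ T, ∫ τ in t₁..t, k τ ^ 2 / (T - τ) ≤ (θ * κ) ^ 2 * Real.log ((T - t₁) / (T - t)) + B))) :
    ∃ k : ℝ → ℝ, Measurable k ∧ (∀ τ, 0 ≤ k τ ∧ k τ ≤ 1) ∧
      (∀ t ∈ Set.Ico 0 T, ∀ M : ℝ, (∀ x, ‖u t x‖ ≤ M) → |∫ x, ⟪Literature.Analysis.FluidPDE.curl (u t) x, fderiv ℝ (u t) x (Literature.Analysis.FluidPDE.curl (u t) x)⟫_ℝ| ≤ k t * M * Real.sqrt (∫ x, ‖Literature.Analysis.FluidPDE.curl (u t) x‖ ^ 2) * Real.sqrt (∫ x, Literature.Analysis.FluidPDE.frobeniusNormSq (fderiv ℝ (Literature.Analysis.FluidPDE.curl (u t)) x))) ∧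
      (∀ t ∈ Set.Ico 0 T, k t ≤ sInf {κ : ℝ | (∀ (v : EuclideanSpace ℝ (Fin 3) → EuclideanSpace ℝ (Fin 3)) (M B : ℝ), ContDiff ℝ (⊤ : ℕ∞) v → Literature.Analysis.FluidPDE.VectorCalculus.IsDivFree v → (∀ x, ‖v x‖ ≤ M) → (∀ x, ‖fderiv ℝ v x‖ ≤ B) → (∫⁻ x, ‖iteratedFDeriv ℝ 0 v x‖ₑ ^ 2 < ⊤) → (∫⁻ x, ‖iteratedFDeriv ℝ 1 v x‖ₑ ^ 2 < ⊤) → (∫⁻ x, ‖iteratedFDeriv ℝ 2 v x‖ₑ ^ 2 < ⊤) → |∫ x, ⟪Literature.Analysis.FluidPDE.curl v x, fderiv ℝ v x (Literature.Analysis.FluidPDE.curl v x)⟫_ℝ| ≤ κ * M * Real.sqrt (∫ x, ‖Literature.Analysis.FluidPDE.curl v x‖ ^ 2) * Real.sqrt (∫ x, Literature.Analysis.FluidPDE.frobeniusNormSq (fderiv ℝ (Literature.Analysis.FluidPDE.curl v) x)))}) ∧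
      (∀ t ∈ Set.Ico 0 T, ∀ m : ℝ, 0 ≤ m → m < k t → (∃ M : ℝ, (∀ x, ‖u t x‖ ≤ M) ∧ m * M * Real.sqrt (∫ x, ‖Literature.Analysis.FluidPDE.curl (u t) x‖ ^ 2) * Real.sqrt (∫ x, Literature.Analysis.FluidPDE.frobeniusNormSq (fderiv ℝ (Literature.Analysis.FluidPDE.curl (u t)) x)) < |∫ x, ⟪Literature.Analysis.FluidPDE.curl (u t) x, fderiv ℝ (u t) x (Literature.Analysis.FluidPDE.curl (u t) x)⟫_ℝ|)) ∧
      (∀ m : ℝ, m < sInf {κ : ℝ | (∀ (v : EuclideanSpace ℝ (Fin 3) → EuclideanSpace ℝ (Fin 3)) (M B : ℝ), ContDiff ℝ (⊤ : ℕ∞) v → Literature.Analysis.FluidPDE.VectorCalculus.IsDivFree v → (∀ x, ‖v x‖ ≤ M) → (∀ x, ‖fderiv ℝ v x‖ ≤ B) → (∫⁻ x, ‖iteratedFDeriv ℝ 0 v x‖ₑ ^ 2 < ⊤) → (∫⁻ x, ‖iteratedFDeriv ℝ 1 v x‖ₑ ^ 2 < ⊤) → (∫⁻ x, ‖iteratedFDeriv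 ℝ 2 v x‖ₑ ^ 2 < ⊤) → |∫ x, ⟪Literature.Analysis.FluidPDE.curl v x, fderiv ℝ v x (Literature.Analysis.FluidPDE.curl v x)⟫_ℝ| ≤ κ * M * Real.sqrt (∫ x, ‖Literature.Analysis.FluidPDE.curl v x‖ ^ 2) * Real.sqrt (∫ x, Literature.Analysis.FluidPDE.frobeniusNormSq (fderiv ℝ (Literature.Analysis.FluidPDE.curl v) x)))} → ∀ δ : ℝ, δ < 1 → ∀ B : ℝ, ∀ t₁ ∈ Set.Ico 0 T, ∃ t ∈ Set.Ico t₁ T,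
        δ * Real.log ((T - t₁) / (T - t)) + B < ∫ τ in t₁..t, Set.indicator {s : ℝ | m < k s} (fun _ => (1 : ℝ)) τ / (T - τ)) := by
  obtain ⟨k₀, hk₀m, hk₀01, hFW, hmin⟩ := DepletionLadder.exists_canonical_coefficient hν hT hsol hLH hdec
  set K : ℝ := sInf {κ : ℝ | (∀ (v : EuclideanSpace ℝ (Fin 3) → EuclideanSpace ℝ (Fin 3)) (M B : ℝ), ContDiff ℝ (⊤ : ℕ∞) v → Literature.Analysis.FluidPDE.VectorCalculus.IsDivFree v → (∀ x, ‖v x‖ ≤ M) → (∀ x, ‖fderiv ℝ v x‖ ≤ B) → (∫⁻ x, ‖iteratedFDeriv ℝ 0 v x‖ₑ ^ 2 < ⊤) → (∫⁻ x, ‖iteratedFDeriv ℝ 1 v x‖ₑ ^ 2 < ⊤) → (∫⁻ x, ‖iteratedFDeriv ℝ 2 v x‖ₑ ^ 2 < ⊤) → |∫ x, ⟪Literature.Analysis.FluidPDE.curl v x, fderiv ℝ v x (Literature.Analysis.FluidPDE.curl v x)⟫_ℝ| ≤ κ * M * Real.sqrt (∫ x, ‖Literature.Analysis.FluidPDE.curl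 v x‖ ^ 2) * Real.sqrt (∫ x, Literature.Analysis.FluidPDE.frobeniusNormSq (fderiv ℝ (Literature.Analysis.FluidPDE.curl v) x)))} with hK
  have hKpos : 0 < K := lt_trans (by norm_num) DepletionLadder.sharpDepletion_gt
  have huniv := DepletionLadder.flowwise_of_universal DepletionLadder.sharpDepletion_is_universal hν hT hsol hLH hdec
  have hkle : ∀ t ∈ Set.Ico 0 T, k₀ t ≤ K := fun t ht => hmin t ht K hKpos.le (huniv t ht)
  refine ⟨k₀, hk₀m, hk₀01, hFW, hkle, ?_, ?_⟩
  · intro t ht m hm0 hmk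
    by_contra hne
    have hclause : ∀ M : ℝ, (∀ x, ‖u t x‖ ≤ M) → |∫ x, ⟪Literature.Analysis.FluidPDE.curl (u t) x, fderiv ℝ (u t) x (Literature.Analysis.FluidPDE.curl (u t) x)⟫_ℝ| ≤ m * M * Real.sqrt (∫ x, ‖Literature.Analysis.FluidPDE.curl (u t) x‖ ^ 2) * Real.sqrt (∫ x, Literature.Analysis.FluidPDE.frobeniusNormSq (fderiv ℝ (Literature.Analysis.FluidPDE.curl (u t)) x)) := by
      intro M hM
      by_contra hJ
      push Not at hJ
      exact hne ⟨M, hM, hJ⟩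
    exact absurd (hmin t ht m hm0 hclause) (not_le.2 hmk)
  · intro m hm δ hδ B t₁ ht₁
    by_contra hall
    push Not at hall
    apply hnot
    -- parameters
    set m' : ℝ := max m 0 with hm'
    have hm'0 : 0 ≤ m' := le_max_right _ _
    have hm'lt : m' < K := max_lt hm hKpos
    have hmm' : m ≤ m' := le_max_left _ _
    set δ' : ℝ := max δ 0 with hδ'
    have hδ'0 : 0 ≤ δ' := le_max_right _ _
    have hδ'1 : δ' < 1 := max_lt hδ one_pos
    have hδδ' : δ ≤ δ' := le_max_left _ _
    have hKm : m' ^ 2 < K ^ 2 := by nlinarith [mul_pos (sub_pos.2 hm'lt) (add_pos_of_pos_of_nonneg hKpos hm'0)]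
    have hgap : 0 < K ^ 2 - m' ^ 2 := sub_pos.2 hKm
    set θsq : ℝ := (m' ^ 2 + (K ^ 2 - m' ^ 2) * δ') / K ^ 2 with hθsq
    have hθsq0 : 0 ≤ θsq := by rw [hθsq]; positivity
    have hθsq1 : θsq < 1 := by
      rw [hθsq, div_lt_one (by positivity)]
      nlinarith [mul_pos hgap (sub_pos.2 hδ'1)]
    have hθK : θsq * K ^ 2 = m' ^ 2 + (K ^ 2 - m' ^ 2) * δ' := by
      rw [hθsq]; field_simp
    refine ⟨Real.sqrt θsq, Real.sqrt_nonneg _, (Real.sqrt_lt' one_pos).2 (by simpa using hθsq1), fun κ hκ => ?_⟩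
    have hKκ : K ≤ κ := DepletionLadder.sharpDepletion_le hκ
    refine ⟨t₁, ht₁, k₀, (K ^ 2 - m' ^ 2) * B, hk₀m, hk₀01, fun t ht M hM => hFW t ⟨ht₁.1.trans ht.1, ht.2⟩ M hM, ?_⟩
    intro t ht
    have h1 : t₁ ≤ t := ht.1
    have hTt : 0 < T - t := sub_pos.2 ht.2
    have hlog0 : 0 ≤ Real.log ((T - t₁) / (T - t)) :=
      Real.log_nonneg ((one_le_div hTt).2 (by linarith [ht.1]))
    -- the indicator of the `m`-super-level set of `k₀`
    set ind : ℝ → ℝ := Set.indicator {s : ℝ | m < k₀ s} (fun _ => (1 : ℝ)) with hind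
    have hmeasS : MeasurableSet {s : ℝ | m < k₀ s} := measurableSet_lt measurable_const hk₀m
    have hind_meas : Measurable ind := measurable_const.indicator hmeasS
    have hind_val : ∀ τ, ind τ = 0 ∨ ind τ = 1 := fun τ => by
      by_cases hτ : τ ∈ {s : ℝ | m < k₀ s}
      · right; simp [hind, hτ]
      · left; simp [hind, hτ]
    have hind01 : ∀ τ, 0 ≤ ind τ ∧ ind τ ≤ 1 := fun τ => by
      rcases hind_val τ with h | h <;> rw [h] <;> norm_num
    -- integrability
    have hIk := DepletionLadder.intervalIntegrable_coeff_sq_div (T := T) hk₀m hk₀01 h1 ht.2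
    have hIind' := DepletionLadder.intervalIntegrable_coeff_sq_div (T := T) hind_meas hind01 h1 ht.2
    have hind_sq : (fun τ => ind τ ^ 2 / (T - τ)) = fun τ => ind τ / (T - τ) := by
      funext τ; rcases hind_val τ with h | h <;> simp [h]
    have hIind : IntervalIntegrable (fun τ => ind τ / (T - τ)) volume t₁ t := by rw [← hind_sq]; exact hIind'
    have hIone : IntervalIntegrable (fun τ => (1 : ℝ) / (T - τ)) volume t₁ t := by
      refine intervalIntegral.intervalIntegrable_one_div (fun τ hτ => ?_) (continuousOn_const.sub continuousOn_id)
      rw [Set.uIcc_of_le h1] at hτ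
      exact (sub_pos.2 (lt_of_le_of_lt hτ.2 ht.2)).ne'
    set g : ℝ → ℝ := fun τ => m' ^ 2 * ((1 : ℝ) / (T - τ)) + (K ^ 2 - m' ^ 2) * (ind τ / (T - τ)) with hg
    have hIg : IntervalIntegrable g volume t₁ t := (hIone.const_mul _).add (hIind.const_mul _)
    -- pointwise: k₀² ≤ m'² + (K² − m'²)·ind on [t₁, t]
    have hpt : ∀ τ ∈ Set.Icc t₁ t, k₀ τ ^ 2 / (T - τ) ≤ g τ := by
      intro τ hτ
      have hτT : τ ∈ Set.Ico 0 T := ⟨ht₁.1.trans hτ.1, lt_of_le_of_lt hτ.2 ht.2⟩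
      have hTτ : 0 < T - τ := sub_pos.2 hτT.2
      have hgτ : g τ = (m' ^ 2 + (K ^ 2 - m' ^ 2) * ind τ) / (T - τ) := by rw [hg]; ring
      rw [hgτ]
      refine div_le_div_of_nonneg_right ?_ hTτ.le
      by_cases hmk : m < k₀ τ
      · have hi : ind τ = 1 := by simp [hind, Set.indicator_of_mem, hmk]
        rw [hi, mul_one]
        have : k₀ τ ^ 2 ≤ K ^ 2 := pow_le_pow_left₀ (hk₀01 τ).1 (hkle τ hτT) 2
        linarith
      · have hi : ind τ = 0 := by simp [hind, hmk]
        rw [hi, mul_zero, add_zero]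
        exact pow_le_pow_left₀ (hk₀01 τ).1 ((not_lt.1 hmk).trans hmm') 2
    have hmono : ∫ τ in t₁..t, k₀ τ ^ 2 / (T - τ) ≤ ∫ τ in t₁..t, g τ :=
      intervalIntegral.integral_mono_on h1 hIk hIg hpt
    -- evaluate ∫ g
    have hsub : ∫ τ in t₁..t, (1 : ℝ) / (T - τ) = Real.log ((T - t₁) / (T - t)) := by
      have h := intervalIntegral.integral_comp_sub_left (fun x : ℝ => (1 : ℝ) / x) T (a := t₁) (b := t)
      rw [h, integral_one_div_of_pos hTt (sub_pos.2 ht₁.2)]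
    have hgint : ∫ τ in t₁..t, g τ = m' ^ 2 * Real.log ((T - t₁) / (T - t)) + (K ^ 2 - m' ^ 2) * ∫ τ in t₁..t, ind τ / (T - τ) := by
      rw [hg, intervalIntegral.integral_add (hIone.const_mul _) (hIind.const_mul _),
        intervalIntegral.integral_const_mul, intervalIntegral.integral_const_mul, hsub]
    have hI : ∫ τ in t₁..t, ind τ / (T - τ) ≤ δ * Real.log ((T - t₁) / (T - t)) + B := hall t ht
    -- assemble
    have hθκ : (Real.sqrt θsq * κ) ^ 2 = θsq * κ ^ 2 := by rw [mul_pow, Real.sq_sqrt hθsq0]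
    calc ∫ τ in t₁..t, k₀ τ ^ 2 / (T - τ) ≤ ∫ τ in t₁..t, g τ := hmono
      _ = m' ^ 2 * Real.log ((T - t₁) / (T - t)) + (K ^ 2 - m' ^ 2) * ∫ τ in t₁..t, ind τ / (T - τ) := hgint
      _ ≤ m' ^ 2 * Real.log ((T - t₁) / (T - t)) + (K ^ 2 - m' ^ 2) * (δ * Real.log ((T - t₁) / (T - t)) + B) := by
          gcongr
      _ ≤ m' ^ 2 * Real.log ((T - t₁) / (T - t)) + (K ^ 2 - m' ^ 2) * (δ' * Real.log ((T - t₁) / (T - t)) + B) := by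
          gcongr
      _ = (θsq * K ^ 2) * Real.log ((T - t₁) / (T - t)) + (K ^ 2 - m' ^ 2) * B := by rw [hθK]; ring
      _ ≤ (θsq * κ ^ 2) * Real.log ((T - t₁) / (T - t)) + (K ^ 2 - m' ^ 2) * B := by
          gcongr
      _ = (Real.sqrt θsq * κ) ^ 2 * Real.log ((T - t₁) / (T - t)) + (K ^ 2 - m' ^ 2) * B := by rw [hθκ]

end Summit.NavierStokesRegularity.NavierStokesRegularity.Theorems.DepletionLadder.PerFlow

end
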